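/-
Copyright (c) 2026 the pub-hodgecm-mathlib formalisation cell (harness21).  Prover seat hodgecm-mathlib-K2Liu-p02 (g2),
Track B «K2-LIT» ∕ hLiu418 #184♮, unit U6 «FIRST TERM», socket #42 `sig_K2LiuEisensteinResidueIsThetaIntegral` (steward): organ O42.2
«CENTRAL CHARACTER OF THE EISENSTEIN SIDE» of the REPORT-FIRST memo `K2/K2Liu-p02/g2/REPORT-FIRST-42-…md` §−1 rows 1–2 ∕ §3.  2026-09-04.
-/
import Literature.NumberTheory.K2Lit.SiegelEisensteinSeriesDoubled                      -- ★ D2: `siegelDeltaCharacter`, `IsSiegelDeltaSection(Family)`, `eisensteinSeriesDelta`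
import Literature.NumberTheory.K2Lit.DoublingEmbedding                                  -- ★ D3: `iotaV`, `isSiegelDelta_iotaV_diag`
import Literature.NumberTheory.Automorphic.UnitaryGroupAdelicCenter                     -- ★ `adelicOne`, `adelicCenter`
import Summits.HodgeConjecture.HodgeConjecture.Theorems.K2LiuDoublingUnfoldTwist          -- ★ p01: `siegelDeltaCharacter_iotaV_diag`
import Summits.HodgeConjecture.HodgeConjecture.Theorems.K2LiuContinuationsAgree          -- ★ #47a: `continuationsAgree`
import HarnessLib

/-!
# K2_Liu road (hLiu418 = stmt-HodgeConjecture-24832), unit U6 «FIRST TERM», organ O42.2: the CENTRAL CHARACTER of Siegel sections, of the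
# doubled Siegel Eisenstein series, of any continuation of it, and of its residue at the top pole

Cell `pub/hodgecm-mathlib` (D-0151), Track B; socket #42 `sig_K2LiuEisensteinResidueIsThetaIntegral` (STEWARD K2Liu-p02 (g2); LEAD F0P6-plan ruling
«M-154s» (S1) 2026-09-03T23:47:35Z: «files (1) `K2LiuLineThetaCentreAbsorb` (2) `K2LiuSiegelEisensteinCentralCharacter` GO — the kernel-checked form
of S1»).  The centre of `H(𝔸) = U(𝕍 ⊕ −𝕍)(𝔸)` is the scalar torus `u·1_{2n}`, `u ∈ U(1)(𝔸_{L⁺})`; it is the doubling-diagonal image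
`z_u := ι(u·1_V, u·1_V)` (★ `iotaV`, ★ `adelicCenter`), hence lies in the Siegel parabolic `P_Δ(𝔸)` (★ `isSiegelDelta_iotaV_diag`) with
`χ_s(z_u) = χ(det((u·1_V) ⊗ 1)) = χ(u)^{N·M}` INDEPENDENT OF `s` (★ `siegelDeltaCharacter_iotaV_diag`: the modulus `|det_Δ|` is `1` there).  Consequently
every Siegel section, the Eisenstein series `E^Δ(·; f)` (termwise: `z_u` commutes with `H(L⁺)`), every continuation `Es` of `∏(s−p)·E^Δ(·; f_s)`
holomorphic on `{Re s > 0}` (identity theorem, ★ #47a), and every limit `R(h) = lim_{s→½} (s−½)·Es(s,h)/∏(s−p)` transform under `h ↦ z_u·h` by the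
SAME scalar `χ(u)^{N·M}` — whereas the weight-`1` theta integral of leaf D8 is invariant (★ `K2LiuLineThetaCentreAbsorb.doubledLineThetaIntegral_mul_centre`);
for a weight-one `λ` the scalar `χ_λ(u)²` (frame `(N, M) = (2, 1)`) is not identically `1`, which is the steward's finding that #42 AS TYPED (ED. 3∕4)
forces `R ≡ 0` and the reason for the weighted ED. 5 («M-154s» (S2)).

* §1 `coe_iotaV_adelicCenter` (the matrix of `z_u` is `u • 1`), `iotaV_adelicCenter_mul_comm` (`z_u` is central), `det_adelicInl_adelicCenter`
  (`det((u·1_V) ⊗ 1) = u^{N·M}`), `siegelDeltaCharacter_centre` (`χ_s(z_u) = χ(u^{N·M})`, no `s`).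
* §2 `siegelSection_centre_mul ∕ siegelSection_mul_centre` (`f(z_u·h) = χ(u^{N·M})·f(h) = f(h·z_u)`), `eisensteinSeriesDelta_centre_mul` (`E(z_u·h; f) = χ(u^{N·M})·E(h; f)` for a
  section `f` — no convergence hypothesis: `tsum_mul_left` is unconditional over `ℂ`), `eisensteinFamilyDelta_centre_mul`.
* §3 `continuation_centre_mul` — for `(P, Es)` with #41's clauses (i) (holomorphy on `{Re s > 0}`) and (iv) (`Es = ∏(s−p)·E^Δ` on `{Re s > n/2}`):
  `Es s (z_u·h) = χ(u^{N·M})·Es s h` on `{Re s > 0}`; `residue_centre_mul` — the `𝓝[≠] s₀`-limit `R` of `(s−s₀)·Es/∏(s−p)` inherits it.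

Mathlib + ★ only; no `sorry`, no definition, no instance.  HONEST LABEL: HC_CM is proved only modulo the 7 printed citations (2 remaining named
inputs: hLiu418 = stmt-HodgeConjecture-24832, h413 = stmt-HodgeConjecture-24833) until rung 0 closes; this file is a `--supports
stmt-HodgeConjecture-24832 --as helper` file and retires nothing by itself.

References: [Tan1999] V. Tan, *Poles of Siegel Eisenstein series on U(n,n)*, Canad. J. Math. 51 (1999) §1 (the induced representation
`I(s, χ) = Ind(χ|·|^s ∘ det_Δ)`, central character `χ(u)ⁿ` on `u·1_{2n}`); [KudlaRallis1994] S. Kudla, S. Rallis, Ann. of Math. 140 (1994) §1;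
[HarrisKudlaSweet1996] §1 (1.11)–(1.15); [Liu2021] Y. Liu, Camb. J. Math. 9 (2021) App. B §B.3 p. 101 (`J_a(s, μᶜ)`), Lem. B.10.
-/

set_option autoImplicit false
set_option linter.dupNamespace false

noncomputable section

open NumberField MeasureTheory IsDedekindDomain Filter
open scoped Matrix Kronecker Topology

namespace Summit.HodgeConjecture.HodgeConjecture.Cruxes.HLiu418.K2LiuSiegelEisensteinCentralCharacter

open Literature.NumberTheory.Automorphic Literature.NumberTheory.Automorphic.UnitaryGroup
open Literature.NumberTheory.GaloisRepresentations
open Literature.NumberTheory.GelbartRogawski1991 Literature.NumberTheory.GelbartRogawski1991.GRConstruction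
open Literature.NumberTheory.K2Lit.SiegelDoubled
open Summit.HodgeConjecture.HodgeConjecture.Cruxes.HLiu418.K2LiuDoublingUnfoldTwist (siegelDeltaCharacter_iotaV_diag)
open Summit.HodgeConjecture.HodgeConjecture.Cruxes.HLiu418.K2LiuContinuationsAgree (continuationsAgree)

variable (L : Type) [Field L] [NumberField L] [IsCMField L]
variable {N M n : ℕ} (e : Fin N × Fin M ≃ Fin n)
  (dV : Fin N → L) (hdV : ∀ i, IsCMField.complexConj L (dV i) = dV i) (hdV0 : ∀ i, dV i ≠ 0)
  (dW : Fin M → L) (hdW : ∀ i, IsCMField.complexConj L (dW i) = dW i) (hdW0 : ∀ i, dW i ≠ 0)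

/-! ## §1 The centre `z_u = ι(u·1_V, u·1_V)` of `H(𝔸)`: matrix, centrality, `χ_s(z_u)` -/

/-- **`det((u·1_V) ⊗ 1) = u^{N·M}`** in `𝕀_L` for `u ∈ U(1)(𝔸_{L⁺})` (★ `coe_adelicInl`, ★ `coe_adelicCenter`). [cite: HarrisKudlaSweet1996, §1 (1.11)–(1.15)] -/
theorem det_adelicInl_adelicCenter (u : adelicOne (Fp L) L (IsCMField.complexConj L)) :
    Matrix.GeneralLinearGroup.det
        ((adelicInl (Fp L) L (IsCMField.complexConj L) N M (Matrix.diagonal dV) (Matrix.diagonal dW)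
            (adelicCenter (Fp L) L (IsCMField.complexConj L) N (Matrix.diagonal dV) u) :
          adelicPair (Fp L) L (IsCMField.complexConj L) N M (Matrix.diagonal dV) (Matrix.diagonal dW)) :
          GL (Fin N × Fin M) (AdeleRing (𝓞 L) L)) =
      (u : (AdeleRing (𝓞 L) L)ˣ) ^ (N * M) := by
  apply Units.ext
  rw [Matrix.GeneralLinearGroup.val_det_apply, coe_adelicInl, coe_adelicCenter, Matrix.smul_kronecker, Matrix.one_kronecker_one,
    Matrix.det_smul, Matrix.det_one, mul_one, Fintype.card_prod, Fintype.card_fin, Fintype.card_fin, Units.val_pow_eq_pow_val]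

/-- **the matrix of `z_u = ι(u·1_V, u·1_V) ∈ H(𝔸)` is the scalar `u • 1_{2n}`** (★ `iotaV_diag`, ★ `coe_diagG`). [cite: Tan1999, §1] -/
theorem coe_iotaV_adelicCenter (u : adelicOne (Fp L) L (IsCMField.complexConj L)) :
    (((iotaV L e dV hdV dW hdW (adelicCenter (Fp L) L (IsCMField.complexConj L) N (Matrix.diagonal dV) u,
        adelicCenter (Fp L) L (IsCMField.complexConj L) N (Matrix.diagonal dV) u) : HA L e dV hdV dW hdW) :
        GL (Fin (n + n)) (AdeleRing (𝓞 L) L)) : Matrix (Fin (n + n)) (Fin (n + n)) (AdeleRing (𝓞 L) L)) =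
      ((u : (AdeleRing (𝓞 L) L)ˣ) : AdeleRing (𝓞 L) L) • (1 : Matrix (Fin (n + n)) (Fin (n + n)) (AdeleRing (𝓞 L) L)) := by
  rw [iotaV_diag, coe_diagG, UnitaryGroup.coe_reindexGL, UnitaryGroup.coe_blockDiagGL, UnitaryGroup.coe_reindexGL, coe_adelicInl,
    coe_adelicCenter, Matrix.smul_kronecker, Matrix.one_kronecker_one, Matrix.smul_one_eq_diagonal, Matrix.smul_one_eq_diagonal,
    Matrix.reindex_apply, Matrix.reindex_apply, Matrix.submatrix_diagonal_equiv, Matrix.fromBlocks_diagonal, Matrix.submatrix_diagonal_equiv]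
  congr 1
  funext k
  simp only [Function.comp_apply]
  generalize (e₂ (n := n)).symm k = x
  cases x <;> rfl

/-- **`z_u` is central in `H(𝔸)`**: `z_u · h = h · z_u`. [cite: Tan1999, §1] -/
theorem iotaV_adelicCenter_mul_comm (u : adelicOne (Fp L) L (IsCMField.complexConj L)) (h : HA L e dV hdV dW hdW) :
    iotaV L e dV hdV dW hdW (adelicCenter (Fp L) L (IsCMField.complexConj L) N (Matrix.diagonal dV) u,
        adelicCenter (Fp L) L (IsCMField.complexConj L) N (Matrix.diagonal dV) u) * h =
      h * iotaV L e dV hdV dW hdW (adelicCenter (Fp L) L (IsCMField.complexConj L) N (Matrix.diagonal dV) u,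
        adelicCenter (Fp L) L (IsCMField.complexConj L) N (Matrix.diagonal dV) u) := by
  apply Subtype.ext
  apply Units.ext
  rw [Subgroup.coe_mul, Subgroup.coe_mul, Units.val_mul, Units.val_mul, coe_iotaV_adelicCenter, Matrix.smul_mul, Matrix.mul_smul,
    Matrix.one_mul, Matrix.mul_one]

include hdV0 hdW0 in
/-- **`χ_s(z_u) = χ(u^{N·M})`, independent of `s`**: `z_u ∈ P_Δ(𝔸)` acts on `Δ` through `(u·1_V) ⊗ 1`, `χ(det_Δ z_u) = χ(u)^{N·M}` and
`|det_Δ z_u|_{𝔸_L} = 1` (★ `siegelDeltaCharacter_iotaV_diag` + §1). For the socket's frame `(N, M) = (2, 1)`: `χ_λ(u)²`. [cite: Tan1999, §1]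
[cite: HarrisKudlaSweet1996, §1 (1.11)–(1.15)] -/
theorem siegelDeltaCharacter_centre (χ : HeckeCharacter L) (s : ℂ) (u : adelicOne (Fp L) L (IsCMField.complexConj L)) :
    siegelDeltaCharacter L e dV hdV dW hdW χ s
        (iotaV L e dV hdV dW hdW (adelicCenter (Fp L) L (IsCMField.complexConj L) N (Matrix.diagonal dV) u,
          adelicCenter (Fp L) L (IsCMField.complexConj L) N (Matrix.diagonal dV) u)) =
      ((χ ((u : (AdeleRing (𝓞 L) L)ˣ) ^ (N * M)) : ℂˣ) : ℂ) := by
  rw [siegelDeltaCharacter_iotaV_diag L e dV hdV hdV0 dW hdW hdW0, det_adelicInl_adelicCenter]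

/-! ## §2 Siegel sections and the Eisenstein series under the centre -/

include hdV0 hdW0 in
/-- **Siegel sections are `χ(u^{N·M})`-covariant under the centre**: `f(z_u·h) = χ(u^{N·M})·f(h)` (the section law on `z_u ∈ P_Δ(𝔸)`).
[cite: Tan1999, §1] [cite: Liu2021, Lem. B.10 p. 102] -/
theorem siegelSection_centre_mul {χ : HeckeCharacter L} {s : ℂ} {f : HA L e dV hdV dW hdW → ℂ}
    (hf : IsSiegelDeltaSection L e dV hdV dW hdW χ s f) (u : adelicOne (Fp L) L (IsCMField.complexConj L)) (h : HA L e dV hdV dW hdW) :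
    f (iotaV L e dV hdV dW hdW (adelicCenter (Fp L) L (IsCMField.complexConj L) N (Matrix.diagonal dV) u,
          adelicCenter (Fp L) L (IsCMField.complexConj L) N (Matrix.diagonal dV) u) * h) =
      ((χ ((u : (AdeleRing (𝓞 L) L)ˣ) ^ (N * M)) : ℂˣ) : ℂ) * f h := by
  rw [hf _ (isSiegelDelta_iotaV_diag L e dV hdV dW hdW _) h, siegelDeltaCharacter_centre L e dV hdV hdV0 dW hdW hdW0]

include hdV0 hdW0 in
/-- … also on the right (`z_u` central): `f(h·z_u) = χ(u^{N·M})·f(h)`. [cite: Tan1999, §1] -/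
theorem siegelSection_mul_centre {χ : HeckeCharacter L} {s : ℂ} {f : HA L e dV hdV dW hdW → ℂ}
    (hf : IsSiegelDeltaSection L e dV hdV dW hdW χ s f) (u : adelicOne (Fp L) L (IsCMField.complexConj L)) (h : HA L e dV hdV dW hdW) :
    f (h * iotaV L e dV hdV dW hdW (adelicCenter (Fp L) L (IsCMField.complexConj L) N (Matrix.diagonal dV) u,
          adelicCenter (Fp L) L (IsCMField.complexConj L) N (Matrix.diagonal dV) u)) =
      ((χ ((u : (AdeleRing (𝓞 L) L)ˣ) ^ (N * M)) : ℂˣ) : ℂ) * f h := by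
  rw [← iotaV_adelicCenter_mul_comm, siegelSection_centre_mul L e dV hdV hdV0 dW hdW hdW0 hf]

include hdV0 hdW0 in
/-- **THE CENTRAL CHARACTER OF THE DOUBLED SIEGEL EISENSTEIN SERIES**: `E^Δ(z_u·h; f) = χ(u^{N·M})·E^Δ(h; f)` for every Siegel section `f ∈ I(s, χ)` —
termwise (`γ·(z_u·h) = z_u·(γ·h)` since `z_u` is central) and `tsum_mul_left`; NO convergence hypothesis (off the domain of summability both sides are the
junk `0`, consistently). [cite: Tan1999, §1] [cite: KudlaRallis1994, §1] -/
theorem eisensteinSeriesDelta_centre_mul {χ : HeckeCharacter L} {s : ℂ} {f : HA L e dV hdV dW hdW → ℂ}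
    (hf : IsSiegelDeltaSection L e dV hdV dW hdW χ s f) (u : adelicOne (Fp L) L (IsCMField.complexConj L)) (h : HA L e dV hdV dW hdW) :
    eisensteinSeriesDelta L e dV hdV dW hdW f
        (iotaV L e dV hdV dW hdW (adelicCenter (Fp L) L (IsCMField.complexConj L) N (Matrix.diagonal dV) u,
          adelicCenter (Fp L) L (IsCMField.complexConj L) N (Matrix.diagonal dV) u) * h) =
      ((χ ((u : (AdeleRing (𝓞 L) L)ˣ) ^ (N * M)) : ℂˣ) : ℂ) * eisensteinSeriesDelta L e dV hdV dW hdW f h := by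
  unfold eisensteinSeriesDelta
  rw [← tsum_mul_left]
  refine tsum_congr fun q => ?_
  rw [← mul_assoc, ← iotaV_adelicCenter_mul_comm, mul_assoc, siegelSection_centre_mul L e dV hdV hdV0 dW hdW hdW0 hf]

include hdV0 hdW0 in
/-- family form: `E^Δ(z_u·h; f_s) = χ(u^{N·M})·E^Δ(h; f_s)` for a family of Siegel sections. [cite: Tan1999, §1] -/
theorem eisensteinFamilyDelta_centre_mul {χ : HeckeCharacter L} {f : ℂ → HA L e dV hdV dW hdW → ℂ}
    (hf : IsSiegelDeltaSectionFamily L e dV hdV dW hdW χ f) (s : ℂ) (u : adelicOne (Fp L) L (IsCMField.complexConj L))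
    (h : HA L e dV hdV dW hdW) :
    eisensteinFamilyDelta L e dV hdV dW hdW f s
        (iotaV L e dV hdV dW hdW (adelicCenter (Fp L) L (IsCMField.complexConj L) N (Matrix.diagonal dV) u,
          adelicCenter (Fp L) L (IsCMField.complexConj L) N (Matrix.diagonal dV) u) * h) =
      ((χ ((u : (AdeleRing (𝓞 L) L)ˣ) ^ (N * M)) : ℂˣ) : ℂ) * eisensteinFamilyDelta L e dV hdV dW hdW f s h :=
  eisensteinSeriesDelta_centre_mul L e dV hdV hdV0 dW hdW hdW0 (hf s) u h

/-! ## §3 Any continuation `Es` of `∏(s−p)·E^Δ` and its residue inherit the central character -/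

include hdV0 hdW0 in
/-- **Continuations are `χ(u^{N·M})`-covariant on `{Re s > 0}`.**  For a family of Siegel sections `f`, a finite `P` and `Es : ℂ → H(𝔸) → ℂ` with
#41's clause (i) «`s ↦ Es s h` holomorphic on `{0 < Re s}` for every `h`» and clause (iv) «`Es s h = ∏_{p∈P}(s−p)·E^Δ(h; f_s)` for `Re s > n/2`»:
`Es s (z_u·h) = χ(u^{N·M})·Es s h` whenever `0 < Re s` — both sides are holomorphic on the convex `{Re s > 0}` and agree on `{Re s > n/2}` by §2
(★ #47a `continuationsAgree` with `P = ∅`). [cite: Tan1999, §1] [cite: Liu2021, Lem. B.10 p. 102] -/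
theorem continuation_centre_mul {χ : HeckeCharacter L} {f : ℂ → HA L e dV hdV dW hdW → ℂ}
    (hf : IsSiegelDeltaSectionFamily L e dV hdV dW hdW χ f) (P : Finset ℂ) (Es : ℂ → HA L e dV hdV dW hdW → ℂ)
    (hhol : ∀ h : HA L e dV hdV dW hdW, DifferentiableOn ℂ (fun s => Es s h) {s : ℂ | 0 < s.re})
    (heq : ∀ (s : ℂ) (h : HA L e dV hdV dW hdW), (n : ℝ) / 2 < s.re →
      Es s h = (∏ p ∈ P, (s - p)) * eisensteinFamilyDelta L e dV hdV dW hdW f s h)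
    (u : adelicOne (Fp L) L (IsCMField.complexConj L)) (h : HA L e dV hdV dW hdW) {s : ℂ} (hs : 0 < s.re) :
    Es s (iotaV L e dV hdV dW hdW (adelicCenter (Fp L) L (IsCMField.complexConj L) N (Matrix.diagonal dV) u,
          adelicCenter (Fp L) L (IsCMField.complexConj L) N (Matrix.diagonal dV) u) * h) =
      ((χ ((u : (AdeleRing (𝓞 L) L)ˣ) ^ (N * M)) : ℂˣ) : ℂ) * Es s h := by
  set z := iotaV L e dV hdV dW hdW (adelicCenter (Fp L) L (IsCMField.complexConj L) N (Matrix.diagonal dV) u,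
    adelicCenter (Fp L) L (IsCMField.complexConj L) N (Matrix.diagonal dV) u) with hz
  set c : ℂ := ((χ ((u : (AdeleRing (𝓞 L) L)ˣ) ^ (N * M)) : ℂˣ) : ℂ) with hc
  have hhalf : {w : ℂ | (n : ℝ) / 2 < w.re} ⊆ {w : ℂ | 0 < w.re} := fun w hw =>
    lt_of_le_of_lt (by positivity) (show (n : ℝ) / 2 < w.re from hw)
  have hconv : Convex ℝ {w : ℂ | 0 < w.re} := convex_halfSpace_re_gt 0
  have hopen : IsOpen {w : ℂ | 0 < w.re} := Complex.continuous_re.isOpen_preimage _ isOpen_Ioi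
  have key := continuationsAgree {w : ℂ | 0 < w.re} {w : ℂ | 0 < w.re} ∅ Set.finite_empty hopen hconv hopen hconv ((n : ℝ) / 2) hhalf hhalf
    (fun w => Es w (z * h)) (fun w => c * Es w h)
    (by rw [Set.sdiff_empty]; exact hhol (z * h))
    (by rw [Set.sdiff_empty]; exact (hhol h).const_mul c)
    (fun w hw => by
      rw [heq w (z * h) hw, heq w h hw, hz, eisensteinFamilyDelta_centre_mul L e dV hdV hdV0 dW hdW hdW0 hf, ← hc]
      ring)
  exact key (by rw [Set.inter_self, Set.sdiff_empty]; exact hs)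

include hdV0 hdW0 in
/-- **The residue inherits the central character.**  Under the hypotheses of `continuation_centre_mul`, if `(s−s₀)·Es(s,·)/∏_{p∈P}(s−p)` has
`𝓝[≠] s₀`-limits `R(h)` and `R(z_u·h)` at `h` and `z_u·h` for some `s₀` with `0 < Re s₀`, then `R(z_u·h) = χ(u^{N·M})·R(h)`. (Near `s₀` the two
difference quotients differ by the constant factor; limits along the `NeBot` filter `𝓝[≠] s₀` are unique.) [cite: Liu2021, Lem. B.12 pp. 103–104] -/
theorem residue_centre_mul {χ : HeckeCharacter L} {f : ℂ → HA L e dV hdV dW hdW → ℂ}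
    (hf : IsSiegelDeltaSectionFamily L e dV hdV dW hdW χ f) (P : Finset ℂ) (Es : ℂ → HA L e dV hdV dW hdW → ℂ)
    (hhol : ∀ h : HA L e dV hdV dW hdW, DifferentiableOn ℂ (fun s => Es s h) {s : ℂ | 0 < s.re})
    (heq : ∀ (s : ℂ) (h : HA L e dV hdV dW hdW), (n : ℝ) / 2 < s.re →
      Es s h = (∏ p ∈ P, (s - p)) * eisensteinFamilyDelta L e dV hdV dW hdW f s h)
    (u : adelicOne (Fp L) L (IsCMField.complexConj L)) (h : HA L e dV hdV dW hdW) {s₀ : ℂ} (hs₀ : 0 < s₀.re) {R Rz : ℂ}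
    (hR : Tendsto (fun s : ℂ => (s - s₀) * (Es s h / ∏ p ∈ P, (s - p))) (𝓝[≠] s₀) (𝓝 R))
    (hRz : Tendsto (fun s : ℂ => (s - s₀) * (Es s
      (iotaV L e dV hdV dW hdW (adelicCenter (Fp L) L (IsCMField.complexConj L) N (Matrix.diagonal dV) u,
          adelicCenter (Fp L) L (IsCMField.complexConj L) N (Matrix.diagonal dV) u) * h) / ∏ p ∈ P, (s - p))) (𝓝[≠] s₀) (𝓝 Rz)) :
    Rz = ((χ ((u : (AdeleRing (𝓞 L) L)ˣ) ^ (N * M)) : ℂˣ) : ℂ) * R := by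
  set c : ℂ := ((χ ((u : (AdeleRing (𝓞 L) L)ˣ) ^ (N * M)) : ℂˣ) : ℂ) with hc
  -- near `s₀` (indeed on the open half-plane `{Re s > 0} ∋ s₀`) the translated quotient is `c` times the untranslated one
  have hev : ∀ᶠ s in 𝓝[≠] s₀, (s - s₀) * (Es s
      (iotaV L e dV hdV dW hdW (adelicCenter (Fp L) L (IsCMField.complexConj L) N (Matrix.diagonal dV) u,
          adelicCenter (Fp L) L (IsCMField.complexConj L) N (Matrix.diagonal dV) u) * h) / ∏ p ∈ P, (s - p)) =
      c * ((s - s₀) * (Es s h / ∏ p ∈ P, (s - p))) := by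
    have hopen : IsOpen {w : ℂ | 0 < w.re} := Complex.continuous_re.isOpen_preimage _ isOpen_Ioi
    filter_upwards [mem_nhdsWithin_of_mem_nhds (hopen.mem_nhds hs₀)] with s hs
    rw [continuation_centre_mul L e dV hdV hdV0 dW hdW hdW0 hf P Es hhol heq u h hs, ← hc]
    ring
  exact tendsto_nhds_unique (hRz.congr' hev) (hR.const_mul c)

end Summit.HodgeConjecture.HodgeConjecture.Cruxes.HLiu418.K2LiuSiegelEisensteinCentralCharacter

end
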